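import Literature.NumberTheory.EllipticCurves.TakahashiDegreeFormulaProofs
import Literature.NumberTheory.Automorphic.BrandtXiSetupIndependence
import Literature.NumberTheory.Automorphic.BrandtModuleEichlerPackageProofs
import HarnessLib

/-!
# Takahashi 2001, Thm. 2.3: independence of the Brandt setup (towards `takahashi2001_thm_2_3`)

Topic `Literature/NumberTheory/EllipticCurves`, sibling of `TakahashiDegreeFormula.lean` (the
NAMED FACT `takahashi2001_thm_2_3`, Takahashi 2001 Thm. 2.3 for `D = 1`) and of
`TakahashiDegreeFormulaProofs.lean` (the algebra of §2 and the glue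
`takahashi2001_thm_2_3_of_brandtDictionary`); theorems only.

The named fact quantifies over *every* Brandt setup `S : Brandt.XiSetup M r` (module docstring
of `TakahashiDegreeFormula.lean`, rendering (iii): "`h_r = S.xi (a_n(W))_n` for EVERY Brandt
setup … Eichler orders of the same level are locally conjugate, so every setup gives isomorphic
Brandt data"), whereas the geometric dictionary of Takahashi p. 84 (Ribet 1990 §3; Buzzard
Thm. 4.7) — `X_r(J₀(rM)) ≅ ℤ[Cls O]⁰`, Hecke- and pairing-compatible — is an identification with
the Brandt module of ONE Eichler order `O` of level `M` (the one cut out by the supersingular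
points) in ONE quaternion algebra of discriminant `r`. The passage from one setup to all of them
is the independence of `ξ` from the setup, now a theorem of the tree
(`Brandt.XiSetup.xi_eq_xi`, `BrandtXiSetupIndependence.lean`: uniqueness of the algebra,
Vignéras III Thm. 3.1, and local conjugacy + connectedness of Eichler orders of the same level,
Vignéras II §2 Lemme 2.4, III §5). This file records the resulting reductions:

* `takahashi2001_thm_2_3.conclusion_iff` — the conclusion of the fact for `(W, P, S)` depends on
  `S` only through `S.xi (a(W))`, hence holds for `S` iff it holds for `S'`;
* `takahashi2001_thm_2_3_of_exists_setup` — **the fact follows from its conclusion for ONE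
  setup** `S₀ = S₀(W, M, r, P)` per optimal curve;
* `takahashi2001_thm_2_3_of_brandtDictionary_one` — **the fact from the character-group
  dictionary in ONE setup**: the hypothesis of `takahashi2001_thm_2_3_of_brandtDictionary`
  (sublattice `X ⊆ ℤ^{Cls O}`, adjoint `π^*, π_*` for Gross's pairing, `π_* π^* = δ`,
  `u_E(x_r,x_r) = ord_r Δ_min`, generator `g` of the `a(W)`-eigen-line with `π^* x_r = j g`)
  is now required for a single setup of type `(M, r)` — exactly what (M1)–(M5) of the module
  docstring of `TakahashiDegreeFormulaProofs.lean` provide — instead of for every setup.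

* `takahashi2001_thm_2_3.nonempty_xiSetup`, `takahashi2001_thm_2_3.modularDegree_le_brandtXi_mul'`
  — Brandt setups of type `(M, r)` exist for `r` prime and `M r` squarefree (the tree's theorem
  `nonempty_eichlerPackage_holds`), so the corollary `δ_1(N) ≤ ξ(E; N/r, r) · ord_r Δ_min(E)` of
  the fact file holds without its `Nonempty` hypothesis.

What remains for `takahashi2001_thm_2_3_holds` is unchanged otherwise: the Néron-model /
character-group dictionary (M1), (M2), (M4) and multiplicity one (M5) for that one setup.

## References

* [Takahashi2001] S. Takahashi, J. Number Theory 90 (2001) 74–88, doi:10.1006/jnth.2000.2614,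
  §2 Thm. 2.3 (p. 79) and §3.2, proof of Thm. 3.8 (p. 84). READ.
* [Ribet1990] K. Ribet, Invent. Math. 100 (1990), §3.
* [VignerasLNM800] M.-F. Vignéras, LNM 800 (1980), Ch. III §3 Thm. 3.1, §5.
-/

namespace Literature.NumberTheory.EllipticCurves

open Literature.NumberTheory.Automorphic Literature.NumberTheory.EllipticCurves.ModularForms

/-- **The conclusion of Thm. 2.3 does not depend on the Brandt setup**: for setups `S, S'` of
type `(M, r)` the statements `∃ i j, 0 < i ∧ i j = c ∧ i ∣ S.xi λ ∧ δ i = S.xi λ · j` and the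
same with `S'` are equivalent, because `S.xi λ = S'.xi λ` (`Brandt.XiSetup.xi_eq_xi`). [cite: Takahashi2001, Thm. 2.3 with proof of Thm. 3.8 (p. 84)] [cite: VignerasLNM800, Ch. III §5] -/
theorem takahashi2001_thm_2_3.conclusion_iff {M r : ℕ} (S S' : Brandt.XiSetup M r)
    (lam : ℕ → ℤ) (c δ : ℕ) :
    (∃ i j : ℕ, 0 < i ∧ i * j = c ∧ i ∣ S.xi lam ∧ δ * i = S.xi lam * j) ↔
      ∃ i j : ℕ, 0 < i ∧ i * j = c ∧ i ∣ S'.xi lam ∧ δ * i = S'.xi lam * j := by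
  rw [Brandt.XiSetup.xi_eq_xi S S' lam]

/-- **`takahashi2001_thm_2_3` from its conclusion in one setup per optimal curve**: if for every
`(W, M, r, P)` as in the fact (whenever a setup of type `(M, r)` exists at all) SOME Brandt
setup `S₀` satisfies the conclusion, then every setup does. [cite: Takahashi2001, Thm. 2.3 with proof of Thm. 3.8 (p. 84)] -/
theorem takahashi2001_thm_2_3_of_exists_setup
    (h : ∀ (W : WeierstrassCurve ℚ) [W.IsElliptic] (M r : ℕ) [NeZero (M * r)],
      r.Prime → Squarefree (M * r) → W.conductorNorm ℤ = M * r →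
      ∀ P : ModularParametrizationData W (M * r),
        (∀ (W' : WeierstrassCurve ℚ) [W'.IsElliptic] (P' : ModularParametrizationData W' (M * r)),
            P'.f = P.f → P.modularDegree ≤ P'.modularDegree) →
        Nonempty (Brandt.XiSetup M r) →
        ∃ (S₀ : Brandt.XiSetup M r) (i j : ℕ), 0 < i ∧
          i * j = (W.minimalDiscriminantNorm ℤ).factorization r ∧
          i ∣ S₀.xi (fun n => W.LFunction n) ∧
          P.modularDegree * i = S₀.xi (fun n => W.LFunction n) * j) :
    takahashi2001_thm_2_3 := by
  intro W _ M r _ hr hsq hN P hmin S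
  obtain ⟨S₀, i, j, hi, hij, hdvd, hδ⟩ := h W M r hr hsq hN P hmin ⟨S⟩
  rw [Brandt.XiSetup.xi_eq_xi S₀ S] at hdvd hδ
  exact ⟨i, j, hi, hij, hdvd, hδ⟩

/-- **`takahashi2001_thm_2_3` from the character-group dictionary in ONE setup** (Takahashi
2001 §2 with the identification of p. 84, which concerns one Eichler order — the supersingular
one — in one quaternion algebra of discriminant `r`): as
`takahashi2001_thm_2_3_of_brandtDictionary`, but the data `(X, π^*, π_*, g, j)` are required in
a single Brandt setup `S₀` of type `(M, r)` for each `(W, M, r, P)`; the conclusion for every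
other setup follows from `Brandt.XiSetup.xi_eq_xi`. [cite: Takahashi2001, Thm. 2.3 and proof of Thm. 3.8 (p. 84)] [cite: Ribet1990, §3] -/
theorem takahashi2001_thm_2_3_of_brandtDictionary_one
    (H : ∀ (W : WeierstrassCurve ℚ) [W.IsElliptic] (M r : ℕ) [NeZero (M * r)],
      r.Prime → Squarefree (M * r) → W.conductorNorm ℤ = M * r →
      ∀ P : ModularParametrizationData W (M * r),
        (∀ (W' : WeierstrassCurve ℚ) [W'.IsElliptic] (P' : ModularParametrizationData W' (M * r)),
            P'.f = P.f → P.modularDegree ≤ P'.modularDegree) →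
        Nonempty (Brandt.XiSetup M r) →
        ∃ (S₀ : Brandt.XiSetup M r) (_ : Fintype (Brandt.ClassSet S₀.O))
          (X : Submodule ℤ (Brandt.ClassSet S₀.O → ℤ)) (pb : ℤ →ₗ[ℤ] X) (pf : X →ₗ[ℤ] ℤ)
          (g : X) (j : ℤ),
          (∀ (a : ℤ) (y : X),
              ∑ i, (Brandt.weight S₀.O i : ℤ) * (pb a : Brandt.ClassSet S₀.O → ℤ) i *
                  (y : Brandt.ClassSet S₀.O → ℤ) i =
                ((W.minimalDiscriminantNorm ℤ).factorization r : ℤ) * a * pf y) ∧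
          (∀ a : ℤ, pf (pb a) = (P.modularDegree : ℤ) * a) ∧
          Function.Surjective pf ∧
          pb 1 = j • g ∧
          Brandt.eigenLattice (M * r) (Brandt.matrix S₀.O) (fun n => W.LFunction n) =
            ℤ ∙ (g : Brandt.ClassSet S₀.O → ℤ)) :
    takahashi2001_thm_2_3 := by
  refine takahashi2001_thm_2_3_of_exists_setup fun W _ M r _ hr hsq hN P hmin hne => ?_
  obtain ⟨S₀, _, X, pb, pf, g, j, hadj, hδ, hsurj, hg, hL⟩ := H W M r hr hsq hN P hmin hne
  exact ⟨S₀, Takahashi2001.exists_ij_of_brandtData W M r hr hN P S₀ X pb pf g j hadj hδ hsurj hg hL⟩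

/-- **Brandt setups of type `(M, r)` exist** for `r` prime and `M r` squarefree: then `M ≥ 1`,
`gcd(M, r) = 1` and `r` has an odd number (one) of prime factors, so the definite quaternion
algebra of discriminant `r` with an Eichler order of level `M` exists
(`nonempty_eichlerPackage_holds`, Vignéras III §3 Thm. 3.1, I §4, II §2, III §5). [cite: VignerasLNM800, Ch. III §3 Thm. 3.1 and §5 Prop. 5.1] -/
theorem takahashi2001_thm_2_3.nonempty_xiSetup {M r : ℕ} (hr : r.Prime)
    (hsq : Squarefree (M * r)) : Nonempty (Brandt.XiSetup M r) := by
  have hM : 0 < M := Nat.pos_of_ne_zero fun h => by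
    rw [h, zero_mul] at hsq; exact not_squarefree_zero hsq
  have hodd : Odd r.primeFactors.card := by
    rw [Nat.Prime.primeFactors hr, Finset.card_singleton]; exact odd_one
  exact Brandt.nonempty_xiSetup_of_nonempty_eichlerPackage nonempty_eichlerPackage_holds hM
    hr.squarefree hodd (Nat.coprime_of_squarefree_mul hsq)

/-- **Corollary of the fact without the existence hypothesis: `δ_1(N) ≤ ξ(E; N/r, r) · ord_r Δ_min(E)`**
(`takahashi2001_thm_2_3.modularDegree_le_brandtXi_mul` with `Nonempty (Brandt.XiSetup M r)`
supplied by `takahashi2001_thm_2_3.nonempty_xiSetup`): the optimal modular degree at squarefree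
level `N = M r`, `r` prime, is at most the definite congruence number `brandtXi M r (a(E))` times
the Tamagawa exponent `c_r = ord_r Δ_min(E)` — `Summit.ABC.ABC.Theses.DefiniteXi.DefiniteRTControl`
for a prime `N⁻ = r` at the optimal curve, granted the named fact. [cite: Takahashi2001, Thm. 2.3] -/
theorem takahashi2001_thm_2_3.modularDegree_le_brandtXi_mul' (h : takahashi2001_thm_2_3)
    (W : WeierstrassCurve ℚ) [W.IsElliptic] (M r : ℕ) [NeZero (M * r)] (hr : r.Prime)
    (hsq : Squarefree (M * r)) (hN : W.conductorNorm ℤ = M * r)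
    (P : ModularParametrizationData W (M * r))
    (hmin : ∀ (W' : WeierstrassCurve ℚ) [W'.IsElliptic] (P' : ModularParametrizationData W' (M * r)),
      P'.f = P.f → P.modularDegree ≤ P'.modularDegree) :
    P.modularDegree ≤
      brandtXi M r (fun n => W.LFunction n) * (W.minimalDiscriminantNorm ℤ).factorization r :=
  h.modularDegree_le_brandtXi_mul W M r hr hsq hN P hmin
    (takahashi2001_thm_2_3.nonempty_xiSetup hr hsq)

end Literature.NumberTheory.EllipticCurves
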